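import Summits.PneNP.PneNP.Theorems.ChebyshevTracialDesignProfileExtrapolation
import HarnessLib

/-!
# Cell pnp-psdrank, route `ChebyshevTracialDesign`: Grigoriev's pseudo-expectation around a matching ANNIHILATES the crossing
# indicator of each of its edges — the multilinear algebra of the crossing-pin lemma

Harmonic backbone of the crux `TracialDecayExp20` (stmt-PneNP-19878), brick 23a (prover g7; route-independent, no Theses import).
For an edge `e = {a, b}` the CROSSING INDICATOR `χ_e(U) = 1[|U ∩ e| = 1] = x_a + x_b − 2x_a x_b` is a multilinear polynomial of
degree `2`. This file records, in the tree's coefficient-vector currency (`zeta q (U) = Σ_{A ⊆ U} q_A`, lit `JohnsonHarmonics`):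
* multiplication of a coefficient vector by a variable, `(x_a·q)(B) = [a ∈ B]·(q_B + q_{B∖a})` (`zeta_mulVar_apply`: its evaluation is
  `[a ∈ U]·zeta q (U)`; `sum_mulVar_mul`: `Σ_B (x_a·q)_B g(B) = Σ_A q_A g(A ∪ {a})`; support grows by one);
* multiplication by the crossing indicator `χ_e·q = x_a·q + x_b·q − 2·x_a·(x_b·q)` (`zeta_mulCross_apply`, `sum_mulCross_mul`,
  `mulCross_eq_zero_of_card`);
* **annihilation** (`knapsack_sum_mulCross_eq_zero`): for a perfect matching `M ∋ e` and ANY coefficient vector `q`,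
  `Σ_B (χ_e·q)_B · knapsackMoment(|M|, t/2, |M[B]|) = 0` — Grigoriev's knapsack pseudo-expectation around `M` (the virtual level
  `cc = 0`, where `U` is a union of edges of `M`) kills every multiple of the crossing indicator of an edge of `M`, because
  `M[A ∪ {a}] = M[A ∪ {b}] = M[A ∪ {a,b}] = M[A] ∪ {e}` (`filter_meets_insert_eq`).
Consumed by the crossing-pin lemma (`…CrossingPin`): a rectangle all of whose matchings contain `e` and all of whose cuts are crossed
by `e` has design value `O(B·√(P_{D−4} μν))` for every exact design of degree `D ≥ 4` — p1's (L2) "crossing cells" step of the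
`r = 1` rung, for ARBITRARY such rectangles. [cite: Grigoriev2001, §1 (definition of B, PDF p. 8) and Lemma 1.4 (PDF p. 8)]
[cite: Rothvoss2017, §2 (PDF p. 6)]
Stature: support/instrument. WHAT THIS IS NOT: nothing on psd rank, no P-vs-NP content. Supports stmt-PneNP-19878.
-/

set_option linter.dupNamespace false -- `Summit.PneNP.PneNP.…`: summit = sub-problem (D-0017)

noncomputable section

namespace Summit.PneNP.PneNP.Theorems.ChebyshevTracialDesignCrossingPinAlgebra

open Finset Literature.Barriers.PneNP Literature.Computability.Complexity
open Literature.Combinatorics.SimpleGraph.CycleSpace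
open Literature.Combinatorics.AssociationSchemes Literature.Combinatorics.AssociationSchemes.JohnsonHarmonics

variable {n : ℕ}

/-! ### §1 Multiplication of a coefficient vector by a variable `x_a` -/

/-- **Evaluation of `x_a · q`**: `zeta (B ↦ [a ∈ B](q_B + q_{B∖a})) (U) = [a ∈ U] · zeta q (U)`. [folklore] -/
theorem zeta_mulVar_apply (a : Fin n) (q : Finset (Fin n) → ℝ) (U : Finset (Fin n)) :
    zeta (fun B => if a ∈ B then q B + q (B.erase a) else 0) U = if a ∈ U then zeta q U else 0 := by
  rw [zeta_apply, zeta_apply]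
  by_cases ha : a ∈ U
  · rw [if_pos ha]
    have hU : U = insert a (U.erase a) := (insert_erase ha).symm
    have hna : a ∉ U.erase a := notMem_erase a U
    rw [hU, sum_powerset_insert hna, sum_powerset_insert hna]
    have h1 : ∑ T ∈ (U.erase a).powerset, (if a ∈ T then q T + q (T.erase a) else 0) = 0 :=
      sum_eq_zero fun T hT => by rw [if_neg (fun h => hna (mem_powerset.1 hT h))]
    have h2 : ∑ T ∈ (U.erase a).powerset, (if a ∈ insert a T then q (insert a T) + q ((insert a T).erase a) else 0) =
        ∑ T ∈ (U.erase a).powerset, q (insert a T) + ∑ T ∈ (U.erase a).powerset, q T := by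
      rw [← sum_add_distrib]
      refine sum_congr rfl fun T hT => ?_
      rw [if_pos (mem_insert_self a T), erase_insert (fun h => hna (mem_powerset.1 hT h))]
    rw [h1, h2, zero_add, add_comm]
  · rw [if_neg ha]
    exact sum_eq_zero fun T hT => by rw [if_neg (fun h => ha (mem_powerset.1 hT h))]

/-- **Pairing `x_a · q` against any function**: `Σ_B [a ∈ B](q_B + q_{B∖a})·g(B) = Σ_A q_A·g(A ∪ {a})`. [folklore] -/
theorem sum_mulVar_mul (a : Fin n) (q g : Finset (Fin n) → ℝ) :
    ∑ B, (if a ∈ B then q B + q (B.erase a) else 0) * g B = ∑ A, q A * g (insert a A) := by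
  classical
  rw [← sum_filter_add_sum_filter_not univ (fun B : Finset (Fin n) => a ∈ B),
    ← sum_filter_add_sum_filter_not univ (fun A : Finset (Fin n) => a ∈ A) (fun A => q A * g (insert a A))]
  have h1 : ∑ B ∈ univ.filter (fun B : Finset (Fin n) => a ∈ B), (if a ∈ B then q B + q (B.erase a) else 0) * g B =
      ∑ B ∈ univ.filter (fun B : Finset (Fin n) => a ∈ B), q B * g (insert a B) +
        ∑ B ∈ univ.filter (fun B : Finset (Fin n) => a ∈ B), q (B.erase a) * g B := by
    rw [← sum_add_distrib]
    refine sum_congr rfl fun B hB => ?_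
    have haB : a ∈ B := (mem_filter.1 hB).2
    rw [if_pos haB, insert_eq_of_mem haB]
    ring
  have h2 : ∑ B ∈ univ.filter (fun B : Finset (Fin n) => ¬ a ∈ B), (if a ∈ B then q B + q (B.erase a) else 0) * g B = 0 :=
    sum_eq_zero fun B hB => by rw [if_neg (mem_filter.1 hB).2, zero_mul]
  have h3 : ∑ B ∈ univ.filter (fun B : Finset (Fin n) => a ∈ B), q (B.erase a) * g B =
      ∑ A ∈ univ.filter (fun A : Finset (Fin n) => ¬ a ∈ A), q A * g (insert a A) := by
    rw [sum_filter_mem_eq_sum_filter_not_mem a (fun B => q (B.erase a) * g B)]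
    refine sum_congr rfl fun A hA => ?_
    rw [erase_insert (mem_filter.1 hA).2]
  rw [h1, h2, h3, add_zero]

/-- Multiplying by a variable raises the support size by at most one. -/
theorem mulVar_eq_zero_of_card {K : ℕ} (a : Fin n) (q : Finset (Fin n) → ℝ)
    (hq : ∀ A : Finset (Fin n), K < A.card → q A = 0) (B : Finset (Fin n)) (hB : K + 1 < B.card) :
    (if a ∈ B then q B + q (B.erase a) else 0) = 0 := by
  split_ifs with ha
  · rw [hq B (by omega), hq (B.erase a) (by rw [card_erase_of_mem ha]; omega), add_zero]
  · rfl

/-! ### §2 Multiplication by the crossing indicator `χ_{ab} = x_a + x_b − 2 x_a x_b` -/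

/-- **Evaluation of `χ_{ab} · q`**: the coefficient vector
`x_a·q + x_b·q − 2·x_a·(x_b·q)` evaluates to `1[{a,b} crosses U] · zeta q (U)`. [folklore] -/
theorem zeta_mulCross_apply (a b : Fin n) (q : Finset (Fin n) → ℝ) (U : Finset (Fin n)) :
    zeta (fun B => (if a ∈ B then q B + q (B.erase a) else 0) + (if b ∈ B then q B + q (B.erase b) else 0) -
        2 * (if a ∈ B then (if b ∈ B then q B + q (B.erase b) else 0) +
          (if b ∈ B.erase a then q (B.erase a) + q ((B.erase a).erase b) else 0) else 0)) U =
      if Crosses U s(a, b) then zeta q U else 0 := by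
  have hlin : (fun B => (if a ∈ B then q B + q (B.erase a) else 0) + (if b ∈ B then q B + q (B.erase b) else 0) -
        2 * (if a ∈ B then (if b ∈ B then q B + q (B.erase b) else 0) +
          (if b ∈ B.erase a then q (B.erase a) + q ((B.erase a).erase b) else 0) else 0)) =
      (fun B => if a ∈ B then q B + q (B.erase a) else 0) + (fun B => if b ∈ B then q B + q (B.erase b) else 0) -
        (2 : ℝ) • (fun B => if a ∈ B then (fun B' => if b ∈ B' then q B' + q (B'.erase b) else 0) B +
          (fun B' => if b ∈ B' then q B' + q (B'.erase b) else 0) (B.erase a) else 0) := by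
    funext B
    simp only [Pi.add_apply, Pi.sub_apply, Pi.smul_apply, smul_eq_mul]
  rw [hlin, map_sub, map_add, map_smul, Pi.sub_apply, Pi.add_apply, Pi.smul_apply, smul_eq_mul,
    zeta_mulVar_apply, zeta_mulVar_apply, zeta_mulVar_apply, zeta_mulVar_apply]
  simp only [crosses_mk]
  by_cases ha : a ∈ U <;> by_cases hb : b ∈ U <;> simp [ha, hb, two_mul]

/-- **Pairing `χ_{ab} · q` against any function**:
`Σ_B (χ_{ab}·q)_B g(B) = Σ_A q_A·(g(A ∪ {a}) + g(A ∪ {b}) − 2 g(A ∪ {a,b}))`. [folklore] -/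
theorem sum_mulCross_mul (a b : Fin n) (q g : Finset (Fin n) → ℝ) :
    ∑ B, ((if a ∈ B then q B + q (B.erase a) else 0) + (if b ∈ B then q B + q (B.erase b) else 0) -
        2 * (if a ∈ B then (if b ∈ B then q B + q (B.erase b) else 0) +
          (if b ∈ B.erase a then q (B.erase a) + q ((B.erase a).erase b) else 0) else 0)) * g B =
      ∑ A, q A * (g (insert a A) + g (insert b A) - 2 * g (insert a (insert b A))) := by
  have h3 : ∑ B, (if a ∈ B then (if b ∈ B then q B + q (B.erase b) else 0) +
      (if b ∈ B.erase a then q (B.erase a) + q ((B.erase a).erase b) else 0) else 0) * g B =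
      ∑ A, q A * g (insert a (insert b A)) := by
    rw [sum_mulVar_mul a (fun B' => if b ∈ B' then q B' + q (B'.erase b) else 0) g, sum_mulVar_mul b q]
  simp only [sub_mul, add_mul, sum_sub_distrib, sum_add_distrib, mul_assoc, ← mul_sum]
  rw [sum_mulVar_mul a q g, sum_mulVar_mul b q g, h3, mul_sum, ← sum_add_distrib, ← sum_sub_distrib]
  exact sum_congr rfl fun A _ => by ring

/-- Multiplying by the crossing indicator raises the support size by at most two. -/
theorem mulCross_eq_zero_of_card {K : ℕ} (a b : Fin n) (q : Finset (Fin n) → ℝ)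
    (hq : ∀ A : Finset (Fin n), K < A.card → q A = 0) (B : Finset (Fin n)) (hB : K + 2 < B.card) :
    ((if a ∈ B then q B + q (B.erase a) else 0) + (if b ∈ B then q B + q (B.erase b) else 0) -
        2 * (if a ∈ B then (if b ∈ B then q B + q (B.erase b) else 0) +
          (if b ∈ B.erase a then q (B.erase a) + q ((B.erase a).erase b) else 0) else 0)) = 0 := by
  have e1 : q B = 0 := hq B (by omega)
  have e2 : q (B.erase a) = 0 := hq _ (by have := pred_card_le_card_erase (s := B) (a := a); omega)
  have e3 : q (B.erase b) = 0 := hq _ (by have := pred_card_le_card_erase (s := B) (a := b); omega)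
  have e4 : q ((B.erase a).erase b) = 0 := hq _ (by
    have h1 := pred_card_le_card_erase (s := B) (a := a)
    have h2 := pred_card_le_card_erase (s := B.erase a) (a := b)
    omega)
  simp only [e1, e2, e3, e4, add_zero, ite_self, mul_zero, sub_zero]

/-! ### §3 Annihilation by the knapsack pseudo-expectation around a matching containing the edge -/

/-- The edges of `M` met by `A ∪ {a}` are those met by `A` together with the edge `{a, b} ∈ M` at `a`. -/
theorem filter_meets_insert_eq (M : PMatch n) {a b : Fin n} (he : s(a, b) ∈ M.1) (A : Finset (Fin n)) :
    (M.1.filter fun e => ∃ v ∈ insert a A, v ∈ e) = insert s(a, b) (M.1.filter fun e => ∃ v ∈ A, v ∈ e) := by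
  ext e
  simp only [mem_filter, mem_insert, exists_eq_or_imp]
  constructor
  · rintro ⟨heM, h | h⟩
    · exact Or.inl (M.2.unique heM he h (Sym2.mem_mk_left a b))
    · exact Or.inr ⟨heM, h⟩
  · rintro (rfl | ⟨heM, h⟩)
    · exact ⟨he, Or.inl (Sym2.mem_mk_left a b)⟩
    · exact ⟨heM, Or.inr h⟩

/-- The same at the other endpoint: `M[A ∪ {b}] = M[A] ∪ {{a,b}}`. -/
theorem filter_meets_insert_eq' (M : PMatch n) {a b : Fin n} (he : s(a, b) ∈ M.1) (A : Finset (Fin n)) :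
    (M.1.filter fun e => ∃ v ∈ insert b A, v ∈ e) = insert s(a, b) (M.1.filter fun e => ∃ v ∈ A, v ∈ e) := by
  have he' : s(b, a) ∈ M.1 := by rw [Sym2.eq_swap]; exact he
  rw [filter_meets_insert_eq M he' A, Sym2.eq_swap]

/-- **Annihilation.** For a perfect matching `M` containing the edge `{a, b}`, ANY coefficient vector `q` and any real `ρ`:
`Σ_B (χ_{ab}·q)_B · knapsackMoment(|M|, ρ, |M[B]|) = 0` — Grigoriev's pseudo-expectation around `M` kills every multiple of the
crossing indicator of an edge of `M` (`M[A ∪ {a}] = M[A ∪ {b}] = M[A ∪ {a,b}]`). [cite: Grigoriev2001, §1 (definition of B, PDF p. 8)] -/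
theorem knapsack_sum_mulCross_eq_zero (M : PMatch n) {a b : Fin n} (he : s(a, b) ∈ M.1) (q : Finset (Fin n) → ℝ) (ρ : ℝ) :
    ∑ B, ((if a ∈ B then q B + q (B.erase a) else 0) + (if b ∈ B then q B + q (B.erase b) else 0) -
        2 * (if a ∈ B then (if b ∈ B then q B + q (B.erase b) else 0) +
          (if b ∈ B.erase a then q (B.erase a) + q ((B.erase a).erase b) else 0) else 0)) *
      knapsackMoment M.1.card ρ (M.1.filter fun e => ∃ v ∈ B, v ∈ e).card = 0 := by
  rw [sum_mulCross_mul a b q (fun B => knapsackMoment M.1.card ρ (M.1.filter fun e => ∃ v ∈ B, v ∈ e).card)]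
  refine sum_eq_zero fun A _ => ?_
  have h1 := filter_meets_insert_eq M he A
  have h2 := filter_meets_insert_eq' M he A
  have h3 : (M.1.filter fun e => ∃ v ∈ insert a (insert b A), v ∈ e) =
      insert s(a, b) (M.1.filter fun e => ∃ v ∈ A, v ∈ e) := by
    rw [filter_meets_insert_eq M he (insert b A), filter_meets_insert_eq' M he A, insert_idem]
  simp only [h1, h2, h3]
  ring

end Summit.PneNP.PneNP.Theorems.ChebyshevTracialDesignCrossingPinAlgebra
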